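import Literature.Geometry.Kaehler.ComplexTorusLefschetzHodgeInvolutionsRational
import Literature.Geometry.Kaehler.ComplexTorusLefschetzHodgeInvolutionsWeilOperator
import HarnessLib

/-!
# André's operator `ᶜL = *_L L *_L` on the invariant cohomology of a complex torus: the string-lowering right inverse of `L`,
# "proportionnel à `ᶜΛ` sur chaque composante de Lefschetz", `Pᵏ(X) = Hᵏ(X) ∩ Ker ᶜL`, defined over `ℚ`, of bidegree `(-1,-1)`

Layer `Literature/Geometry/Kaehler`, namespace `Literature.Geometry.Kaehler.ComplexTorus`; lane `lit-hodgefound` (Track 2 foundations library),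
prover seat `lit-hodgefound-p35` (generation 50, row g50-#8; sequel of rows g50-#4 … g50-#7). THEOREMS ONLY (no definition, no named fact, no instance,
no notation; D-0026 net debt `0`). The operator is written `*_L * lefschetzG η * *_L` throughout (no abbreviation is introduced). Consumed BY NAME,
nothing restated: p34's abstract string calculus (`Algebra/Lie/LefschetzModuleStringReversal`, `…LefschetzInvolution`, `…HodgeInvolution`:
`IsStringReversal.conj_apply_pow_primitive` — `N(eʲp) = e^{j-1}p`, `N p = 0` —, `mul_conj_lefschetzInvolution_mul_eq` (`e N e = e`),
`IsStringReversal.conj_mul_mul_conj_eq` (`N e N = N`), `primitiveSpace_eq_inf_ker_conj_lefschetzInvolution` / `…_conj_hodgeInvolution`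
(`P_{-k} = M_{-k} ∩ ker N`), `dual_apply_pow_primitive` (André's `ᶜΛ(e^{j+1}p) = (j+1)(k-j) eʲp`)), p09's torus dictionary (`lefschetzG_pow_of`,
`of_mem_primitiveSpace_iff_mem_primitiveForms`, `dual_lefschetzG_eq_lefschetzDualG`, `lefschetzG_mem_rationalEnd`, `lefschetzG_mem_rotCommutant`,
`lefschetzPow_mem_typeSubmodule`), row g50-#5 (`lefschetzInvolution_of_eq_of`), row g50-#6 (`IsNSForm.lefschetzInvolution_mem_rationalEnd`,
`lefschetzInvolution_of_apply_mem_typeSubmodule`) and row g50-#7 (`lefschetzInvolution_mem_rotCommutant`).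

SETTING as in rows g50-#4 … g50-#7: `X = E/Λ`, `g = dim_ℂ E`, `η` non-degenerate (`hη`), `L_η = lefschetzG η` on `H•(X; ℂ) = GForm E ℂ`,
`*_L = (hasLefschetzProperty_lefschetzG hη).lefschetzInvolution isZGrading_countingG`, `ᶜL = *_L L_η *_L` (André's notation is `*_L L *_L`; it LOWERS the degree by `2`),
`Λ_η = lefschetzDualG η` (`= ᶜΛ`, the `𝔰𝔩₂`-partner), `Pᵏ = primitiveForms η k`, `Lʲ Pᵏ = lefschetzSummandForms η a j`.

## Source, VERBATIM (held `paper:doi-10-1007-bf02698643`)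

Y. André, *Pour une théorie inconditionnelle des motifs*, Publ. Math. IHÉS 83 (1996) [Andre1996Motifs], §1.1 Lemme 1.1 (p. 11 = chunk p0008 L17–L22): "Soit `x ∈ Hʲ(X)`.
Pour `* = *_L` ou `*_H`, la composante de Lefschetz de `* x` dans `Lⁱ P^{2d-j-2i}(X)` est donnée par `Lⁱ * Lⁱ x - L^{i+1} * L^{i+1} x` […] En effet, après avoir
remarqué que dans les décompositions de Lefschetz respectives de `x` et `Lⁱ x`, on a `(Lⁱ x)_k = x_k` si `k ≤ 2d - 2i - j` et `(Lⁱ x)_k = 0` sinon, on constate un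
télescopage entre les deux termes du second membre"; §1.1 (p. 11 = p0008 L11–L14): "On voit immédiatement
que `Pʲ(X) = Hʲ(X) ∩ Ker *_L L *_L` et que l'opérateur `*_L L *_L = *_H L *_H`, proportionnel à `ᶜΛ` sur chaque composante de Lefschetz, est un inverse à
droite de `L` sur l'image de `L`."; Prop. 1.2 (p. 11): "Les sous-algèbres `ℚ[L, *_L]`, `ℚ[L, *_H]`, `ℚ[L, *_L L *_L]`, `ℚ[L, ᶜΛ]` de `End H*(X)` sont égales";
proof (p. 12 = p0009 L13–L15): "il suffit de la tester sur les générateurs `L` et `*_L L *_L`". J. S. Milne, *Lefschetz classes on abelian varieties* (1999)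
[Milne1999LefschetzClasses], §5 p. 665 (proof of Thm. 5.9: "Kleiman 1968, p. 367" — `Λ` inverse to `L` off the top of the strings). S. L. Kleiman (1968)
[Kleiman1968AlgebraicCycles], §1.4, 1.4.2–1.4.6 (via André and Milne).

## What is proved

* §1 ON THE STRINGS: **`conj_lefschetzInvolution_of_lefschetzPow_succ_of_mem_primitiveForms`** (`ᶜL(L^{j+1}χ) = Lʲχ` for `χ ∈ Pᵏ`, `j + 1 ≤ n = g - k`),
  `conj_lefschetzInvolution_of_of_mem_primitiveForms` (`ᶜL χ = 0`), `conj_lefschetzInvolution_of_eq_of` (`ᶜL : H^{a+2} → Hᵃ` componentwise), and "proportionnel à `ᶜΛ`":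
  **`lefschetzDualG_of_eq_smul_conj_lefschetzInvolution_of_of_mem_lefschetzSummandForms`** (`Λ_η = (j+1)(n-j) · ᶜL` on `L^{j+1} Pᵏ`).
* §2 **`mem_primitiveForms_iff_conj_lefschetzInvolution_of_eq_zero`: `χ ∈ Pᵏ(η) ↔ ᶜL(of k χ) = 0`** (`k ≤ g`) — "`Pʲ(X) = Hʲ(X) ∩ Ker *_L L *_L`" ON THE TORUS; the same
  through Kleiman–Milne's `∗` (`mem_primitiveForms_iff_conj_hodgeInvolution_of_eq_zero`, `*_H L *_H = *_L L *_L` up to the normalisation-free identity of p34).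
* §3 GENERALIZED INVERSES: `lefschetzG_mul_conj_lefschetzInvolution_mul_lefschetzG` (`L ᶜL L = L`: "un inverse à droite de `L` sur l'image de `L`"),
  `conj_lefschetzInvolution_mul_lefschetzG_mul_conj_lefschetzInvolution` (`ᶜL L ᶜL = ᶜL`), componentwise `lefschetzPow_one_conj_lefschetzInvolution_of_lefschetzPow_one`.
* §5 ANDRÉ'S LEMME 1.1: **`of_primitiveProj_eq_sub_pow_mul_conj_pow_apply_of`** — MILNE'S LAGRANGE PROJECTOR `π_{a,r} = ℓ_r(ᶜΛ L)` (p09's `primitiveProj`) EQUALS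
  KLEIMAN–ANDRÉ'S `Lʳ ᶜLʳ - L^{r+1} ᶜL^{r+1}` on `Hᵃ(X; ℂ)`; `of_primitiveProj_lefschetzInvolution_of_apply_eq` (the Lefschetz components of `*_L x` are
  `(Lʳ *_L Lʳ - L^{r+1} *_L L^{r+1}) x`, the Lemme as printed).
* §4 STRUCTURE: **`IsNSForm.conj_lefschetzInvolution_mem_rationalEnd`** (`ᶜL ∈ 𝔤𝔩(H•(X; ℚ))` for `η ∈ NS(X)` non-degenerate — "`ℚ[L, *_L L *_L]` […] de `End H*(X)`"),
  `conj_lefschetzInvolution_mem_rotCommutant` (commutes with the Hodge circle action, `η` of type `(1,1)`), **`conj_lefschetzInvolution_of_apply_mem_typeSubmodule`**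
  (`ᶜL(H^{p+1,q+1} ∩ H^{a+2}) ⊆ H^{p,q} ∩ Hᵃ`: bidegree `(-1,-1)`, like `ᶜΛ`), **`IsNSForm.conj_lefschetzInvolution_of_apply_mem_hodgeClassesIn`** (`ᶜL` maps Hodge classes
  `H^{a+2}(X, ℚ) ∩ H^{p+1,p+1}` to Hodge classes `Hᵃ(X, ℚ) ∩ H^{p,p}`).

## Scope / not here

André's Prop. 1.2 equalities of algebras are p34's abstract `adjoin_pair_conj_lefschetzInvolution_eq_adjoin_pair_dual` (not re-read); Milne's algebraicity is not
formalised. Only invariant forms of complex tori.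
-/

noncomputable section

-- `Module ℂ` / `SMulZeroClass ℂ` synthesis on `E [⋀^Fin k]→L[ℝ] ℂ` (as in `ComplexTorusLefschetzDecomposition`)
set_option maxSynthPendingDepth 3

open Module ContinuousAlternatingMap Function Finset
open Literature.LinearAlgebra.Alternating Literature.LinearAlgebra.Alternating.GForm
open Literature.Algebra.Lie Literature.Analysis.Complex

namespace Literature.Geometry.Kaehler

namespace ComplexTorus

universe uE

/-! ## §1 `ᶜL` on the strings; "proportionnel à `ᶜΛ`" -/

section Strings

variable {E : Type uE} [NormedAddCommGroup E] [NormedSpace ℂ E] [FiniteDimensional ℂ E] [Nontrivial E] {η : E [⋀^Fin 2]→L[ℝ] ℝ}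
  (hη : ∀ v : E, v ≠ 0 → ∃ w : E, η ![v, w] ≠ 0)

include hη

/-- **`ᶜL(L^{j+1}χ) = Lʲχ`** for `χ ∈ Pᵏ(η)`, `k + n = g`, `j + 1 ≤ n` (`a = k + 2j + 2`, `b = k + 2j`): André's `*_L L *_L` steps each Lefschetz string DOWN by one
(p34's `IsStringReversal.conj_apply_pow_primitive`: `N(eʲp) = e^{j-1}p`). [cite: Andre1996Motifs, §1.1 (p. 11), Prop. 1.2] [cite: Kleiman1968AlgebraicCycles, §1.4, 1.4.2] -/
theorem conj_lefschetzInvolution_of_lefschetzPow_succ_of_mem_primitiveForms {g : ℕ} (hg : finrank ℂ E = g) {k n : ℕ} (hkn : k + n = g)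
    {χ : E [⋀^Fin k]→L[ℝ] ℂ} (hχ : χ ∈ primitiveForms η k) {j : ℕ} (hjn : j + 1 ≤ n) {a b : ℕ} (ha : 2 * (j + 1) + k = a) (hb : 2 * j + k = b) :
    ((hasLefschetzProperty_lefschetzG hη).lefschetzInvolution isZGrading_countingG * lefschetzG η *
        (hasLefschetzProperty_lefschetzG hη).lefschetzInvolution isZGrading_countingG) (GForm.of a (lefschetzPow η (j + 1) ha χ)) =
      GForm.of b (lefschetzPow η j hb χ) := by
  rw [← lefschetzG_pow_of η (j + 1) ha χ,
    ((hasLefschetzProperty_lefschetzG hη).isStringReversal_lefschetzInvolution isZGrading_countingG).conj_apply_pow_primitive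
      (of_mem_primitiveSpace_of_mem_primitiveForms hη (by omega) hχ) hjn, if_neg (Nat.succ_ne_zero j), Nat.add_sub_cancel, lefschetzG_pow_of η j hb χ]

/-- **`ᶜL χ = 0` for `χ ∈ Pᵏ(η)`** (`k ≤ g`): `ᶜL` kills the bottom of every string. [cite: Andre1996Motifs, §1.1 (p. 11, "`Pʲ(X) = Hʲ(X) ∩ Ker *_L L *_L`")] -/
theorem conj_lefschetzInvolution_of_of_mem_primitiveForms {k n : ℕ} (hkn : k + n = finrank ℂ E) {χ : E [⋀^Fin k]→L[ℝ] ℂ}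
    (hχ : χ ∈ primitiveForms η k) :
    ((hasLefschetzProperty_lefschetzG hη).lefschetzInvolution isZGrading_countingG * lefschetzG η *
        (hasLefschetzProperty_lefschetzG hη).lefschetzInvolution isZGrading_countingG) (GForm.of k χ) = 0 := by
  have h := ((hasLefschetzProperty_lefschetzG hη).isStringReversal_lefschetzInvolution isZGrading_countingG).conj_apply_pow_primitive
    (of_mem_primitiveSpace_of_mem_primitiveForms hη hkn hχ) (Nat.zero_le n)
  rwa [pow_zero, Module.End.one_apply, if_pos rfl] at h

/-- **`ᶜL : H^{c+2}(X; ℂ) → Hᶜ(X; ℂ)` componentwise** (`(c + 2) + d = 2g`): `ᶜL(of (c+2) z) = of c (ᶜL(of (c+2) z) c)` — three homogeneous steps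
(`*_L : H^{c+2} → Hᵈ`, `L : Hᵈ → H^{d+2}`, `*_L : H^{d+2} → Hᶜ`). [cite: Andre1996Motifs, §1.1 (p. 11)] -/
theorem conj_lefschetzInvolution_of_eq_of {c d : ℕ} (hcd : (c + 2) + d = 2 * finrank ℂ E) (z : E [⋀^Fin (c + 2)]→L[ℝ] ℂ) :
    ((hasLefschetzProperty_lefschetzG hη).lefschetzInvolution isZGrading_countingG * lefschetzG η *
        (hasLefschetzProperty_lefschetzG hη).lefschetzInvolution isZGrading_countingG) (GForm.of (c + 2) z) =
      GForm.of c (((hasLefschetzProperty_lefschetzG hη).lefschetzInvolution isZGrading_countingG * lefschetzG η *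
        (hasLefschetzProperty_lefschetzG hη).lefschetzInvolution isZGrading_countingG) (GForm.of (c + 2) z) c) := by
  have h3 : ((hasLefschetzProperty_lefschetzG hη).lefschetzInvolution isZGrading_countingG * lefschetzG η *
      (hasLefschetzProperty_lefschetzG hη).lefschetzInvolution isZGrading_countingG) (GForm.of (c + 2) z) =
      GForm.of c ((hasLefschetzProperty_lefschetzG hη).lefschetzInvolution isZGrading_countingG (GForm.of (d + 2) (lefschetzPow η 1 (by omega)
        ((hasLefschetzProperty_lefschetzG hη).lefschetzInvolution isZGrading_countingG (GForm.of (c + 2) z) d))) c) := by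
    rw [Module.End.mul_apply, Module.End.mul_apply, lefschetzInvolution_of_eq_of hη hcd z, lefschetzG_of,
      lefschetzInvolution_of_eq_of hη (show (d + 2) + c = 2 * finrank ℂ E by omega), GForm.of_apply_self]
  rw [h3, GForm.of_apply_self]

/-- **"proportionnel à `ᶜΛ` sur chaque composante de Lefschetz": `Λ_η = (j+1)(n-j) · ᶜL` on `L^{j+1} Pᵏ ⊂ Hᵃ`** (`k + n = g`, `j + 1 ≤ n`, `a = k + 2j + 2`): André's
formula `ᶜΛ(L^{j+1}χ) = (j+1)(n-j) Lʲχ` (p34's `dual_apply_pow_primitive`, with `Λ_η = ᶜΛ` the `𝔰𝔩₂`-partner, p09's `dual_lefschetzG_eq_lefschetzDualG`) against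
`ᶜL(L^{j+1}χ) = Lʲχ`. [cite: Andre1996Motifs, §1.1 (p. 11; formula for `ᶜΛ` p. 10)] [cite: Kleiman1968AlgebraicCycles, §1.4, 1.4.6] -/
theorem lefschetzDualG_of_eq_smul_conj_lefschetzInvolution_of_of_mem_lefschetzSummandForms {g : ℕ} (hg : finrank ℂ E = g) {k n j a : ℕ}
    (hkn : k + n = g) (hjn : j + 1 ≤ n) (ha : 2 * (j + 1) + k = a) {x : E [⋀^Fin a]→L[ℝ] ℂ} (hx : x ∈ lefschetzSummandForms η a (j + 1)) :
    lefschetzDualG η (GForm.of a x) =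
      ((((j : ℤ) + 1) * ((n : ℤ) - j) : ℤ) : ℂ) •
        ((hasLefschetzProperty_lefschetzG hη).lefschetzInvolution isZGrading_countingG * lefschetzG η *
          (hasLefschetzProperty_lefschetzG hη).lefschetzInvolution isZGrading_countingG) (GForm.of a x) := by
  rw [lefschetzSummandForms_eq η ha] at hx
  obtain ⟨χ, hχ, rfl⟩ := hx
  rw [conj_lefschetzInvolution_of_lefschetzPow_succ_of_mem_primitiveForms hη hg hkn hχ hjn ha rfl, ← dual_lefschetzG_eq_lefschetzDualG hη,
    ← lefschetzG_pow_of η (j + 1) ha χ,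
    (hasLefschetzProperty_lefschetzG hη).dual_apply_pow_primitive isZGrading_countingG
      (of_mem_primitiveSpace_of_mem_primitiveForms hη (n := n) (by omega) hχ) j,
    lefschetzG_pow_of η j rfl χ]

end Strings

/-! ## §2 `Pᵏ(X) = Hᵏ(X) ∩ Ker ᶜL` -/

section Primitive

variable {E : Type uE} [NormedAddCommGroup E] [NormedSpace ℂ E] [FiniteDimensional ℂ E] [Nontrivial E] {η : E [⋀^Fin 2]→L[ℝ] ℝ}
  (hη : ∀ v : E, v ≠ 0 → ∃ w : E, η ![v, w] ≠ 0)

include hη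

/-- **"`Pʲ(X) = Hʲ(X) ∩ Ker *_L L *_L`" ON THE TORUS: `χ ∈ Pᵏ(η) ↔ ᶜL(of k χ) = 0`** for `k + n = g` (`k ≤ g`) — p34's abstract
`primitiveSpace_eq_inf_ker_conj_lefschetzInvolution` (`P_{-n} = M_{-n} ∩ ker(*_L e *_L)`) and p09's `of_mem_primitiveSpace_iff_mem_primitiveForms`.
[cite: Andre1996Motifs, §1.1 (p. 11)] -/
theorem mem_primitiveForms_iff_conj_lefschetzInvolution_of_eq_zero {k n : ℕ} (hkn : k + n = finrank ℂ E) (χ : E [⋀^Fin k]→L[ℝ] ℂ) :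
    χ ∈ primitiveForms η k ↔
      ((hasLefschetzProperty_lefschetzG hη).lefschetzInvolution isZGrading_countingG * lefschetzG η *
        (hasLefschetzProperty_lefschetzG hη).lefschetzInvolution isZGrading_countingG) (GForm.of k χ) = 0 := by
  rw [← of_mem_primitiveSpace_iff_mem_primitiveForms hη hkn,
    (hasLefschetzProperty_lefschetzG hη).primitiveSpace_eq_inf_ker_conj_lefschetzInvolution isZGrading_countingG, Submodule.mem_inf,
    LinearMap.mem_ker, and_iff_right (of_mem_degreeSpace_countingG_neg hkn χ)]

/-- **`χ ∈ Pᵏ(η) ↔ (∗ L ∗)(of k χ) = 0`** through Kleiman–Milne's `∗` (any normalisation `d`; `*_H L *_H = *_L L *_L`).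
[cite: Andre1996Motifs, §1.1 (p. 11, "`*_L L *_L = *_H L *_H`")] [cite: Milne1999LefschetzClasses, §5 p. 664] -/
theorem mem_primitiveForms_iff_conj_hodgeInvolution_of_eq_zero (d : ℕ) {k n : ℕ} (hkn : k + n = finrank ℂ E) (χ : E [⋀^Fin k]→L[ℝ] ℂ) :
    χ ∈ primitiveForms η k ↔
      ((hasLefschetzProperty_lefschetzG hη).hodgeInvolution isZGrading_countingG d * lefschetzG η *
        (hasLefschetzProperty_lefschetzG hη).hodgeInvolution isZGrading_countingG d) (GForm.of k χ) = 0 := by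
  rw [← of_mem_primitiveSpace_iff_mem_primitiveForms hη hkn,
    (hasLefschetzProperty_lefschetzG hη).primitiveSpace_eq_inf_ker_conj_hodgeInvolution isZGrading_countingG d, Submodule.mem_inf,
    LinearMap.mem_ker, and_iff_right (of_mem_degreeSpace_countingG_neg hkn χ)]

end Primitive

/-! ## §3 `ᶜL` and `L` are generalized inverses of each other -/

section Inverse

variable {E : Type uE} [NormedAddCommGroup E] [NormedSpace ℂ E] [FiniteDimensional ℂ E] [Nontrivial E] {η : E [⋀^Fin 2]→L[ℝ] ℝ}
  (hη : ∀ v : E, v ≠ 0 → ∃ w : E, η ![v, w] ≠ 0)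

include hη

/-- **"un inverse à droite de `L` sur l'image de `L`": `L ᶜL L = L`** on `H•(X; ℂ)` (p34's `mul_conj_lefschetzInvolution_mul_eq`).
[cite: Andre1996Motifs, §1.1 (p. 11)] [cite: Milne1999LefschetzClasses, §5 p. 665 (proof of Thm. 5.9)] -/
theorem lefschetzG_mul_conj_lefschetzInvolution_mul_lefschetzG :
    lefschetzG η * ((hasLefschetzProperty_lefschetzG hη).lefschetzInvolution isZGrading_countingG * lefschetzG η *
      (hasLefschetzProperty_lefschetzG hη).lefschetzInvolution isZGrading_countingG) * lefschetzG η = lefschetzG η :=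
  (hasLefschetzProperty_lefschetzG hη).mul_conj_lefschetzInvolution_mul_eq isZGrading_countingG

/-- **`ᶜL L ᶜL = ᶜL`** (p34's `IsStringReversal.conj_mul_mul_conj_eq`). [cite: Andre1996Motifs, §1.1 (p. 11)] [cite: Kleiman1968AlgebraicCycles, §1.4, 1.4.2] -/
theorem conj_lefschetzInvolution_mul_lefschetzG_mul_conj_lefschetzInvolution :
    ((hasLefschetzProperty_lefschetzG hη).lefschetzInvolution isZGrading_countingG * lefschetzG η *
        (hasLefschetzProperty_lefschetzG hη).lefschetzInvolution isZGrading_countingG) * lefschetzG η *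
      ((hasLefschetzProperty_lefschetzG hη).lefschetzInvolution isZGrading_countingG * lefschetzG η *
        (hasLefschetzProperty_lefschetzG hη).lefschetzInvolution isZGrading_countingG) =
      (hasLefschetzProperty_lefschetzG hη).lefschetzInvolution isZGrading_countingG * lefschetzG η *
        (hasLefschetzProperty_lefschetzG hη).lefschetzInvolution isZGrading_countingG :=
  ((hasLefschetzProperty_lefschetzG hη).isStringReversal_lefschetzInvolution isZGrading_countingG).conj_mul_mul_conj_eq
    (hasLefschetzProperty_lefschetzG hη) isZGrading_countingG

/-- **Componentwise: `L_η(ᶜL(L_η x)) = L_η x` for every `x ∈ Hᵃ(X; ℂ)`** (`(a + 2) + d = 2g`; the degreewise `L_η = lefschetzPow η 1`).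
[cite: Andre1996Motifs, §1.1 (p. 11)] -/
theorem lefschetzPow_one_conj_lefschetzInvolution_of_lefschetzPow_one {a d : ℕ} (had : (a + 2) + d = 2 * finrank ℂ E) (h : 2 * 1 + a = a + 2)
    (x : E [⋀^Fin a]→L[ℝ] ℂ) :
    lefschetzPow η 1 h (((hasLefschetzProperty_lefschetzG hη).lefschetzInvolution isZGrading_countingG * lefschetzG η *
        (hasLefschetzProperty_lefschetzG hη).lefschetzInvolution isZGrading_countingG) (GForm.of (a + 2) (lefschetzPow η 1 h x)) a) =
      lefschetzPow η 1 h x := by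
  have key := LinearMap.congr_fun (lefschetzG_mul_conj_lefschetzInvolution_mul_lefschetzG hη) (GForm.of a x)
  rw [Module.End.mul_apply, Module.End.mul_apply, lefschetzG_of, conj_lefschetzInvolution_of_eq_of hη had, lefschetzG_of] at key
  exact GForm.of_injective (a + 2) key

end Inverse

/-! ## §4 `ᶜL` is defined over `ℚ`, commutes with the circle action, and has bidegree `(-1,-1)` -/

section Structure

variable {ι : Type*} [Fintype ι] [DecidableEq ι] {E : Type uE} [NormedAddCommGroup E] [NormedSpace ℂ E] [FiniteDimensional ℂ E] [Nontrivial E]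
  (Φ : (ι → ℝ) ≃L[ℝ] E) {η : E [⋀^Fin 2]→L[ℝ] ℝ}

/-- **`ᶜL ∈ 𝔤𝔩(H•(X; ℚ))`** for every non-degenerate `η ∈ NS(X)` ("`ℚ[L, *_L L *_L]` […] de `End H*(X)`"): `*_L` (row g50-#6) and `L_η` (p09) are rational operators.
[cite: Andre1996Motifs, Prop. 1.2 (p. 11)] [cite: Milne1999LefschetzClasses, §5 p. 665 (proof of Thm. 5.9)] -/
theorem IsNSForm.conj_lefschetzInvolution_mem_rationalEnd (hNS : IsNSForm Φ η) (hη : ∀ v : E, v ≠ 0 → ∃ w : E, η ![v, w] ≠ 0) :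
    (hasLefschetzProperty_lefschetzG hη).lefschetzInvolution isZGrading_countingG * lefschetzG η *
      (hasLefschetzProperty_lefschetzG hη).lefschetzInvolution isZGrading_countingG ∈ rationalEnd Φ :=
  Subalgebra.mul_mem _ (Subalgebra.mul_mem _ (hNS.lefschetzInvolution_mem_rationalEnd Φ hη)
    (lefschetzG_mem_rationalEnd Φ (hNS.ofRealForm_mem_rationalForms Φ))) (hNS.lefschetzInvolution_mem_rationalEnd Φ hη)

omit [Fintype ι] [DecidableEq ι] in
/-- **`ᶜL ∈ rotCommutant`**: `ᶜL` commutes with the Hodge circle action for `η` of type `(1,1)` (so do `*_L`, row g50-#7, and `L_η`, p09).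
[cite: LooijengaLunts1997, §1 (1.6)–(1.7)] [cite: Andre1996Motifs, §1.1 (p. 11)] -/
theorem conj_lefschetzInvolution_mem_rotCommutant (h11 : ∀ u v : E, η ![Complex.I • u, Complex.I • v] = η ![u, v])
    (hη : ∀ v : E, v ≠ 0 → ∃ w : E, η ![v, w] ≠ 0) :
    (hasLefschetzProperty_lefschetzG hη).lefschetzInvolution isZGrading_countingG * lefschetzG η *
      (hasLefschetzProperty_lefschetzG hη).lefschetzInvolution isZGrading_countingG ∈ rotCommutant E := by
  intro θ y
  rw [Module.End.mul_apply, Module.End.mul_apply, lefschetzInvolution_mem_rotCommutant h11 hη θ y, lefschetzG_mem_rotCommutant h11 θ,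
    lefschetzInvolution_mem_rotCommutant h11 hη θ, Module.End.mul_apply, Module.End.mul_apply]

omit [Fintype ι] [DecidableEq ι] in
/-- **`ᶜL` HAS BIDEGREE `(-1,-1)`: `ᶜL(H^{p+1,q+1} ∩ H^{a+2}) ⊆ H^{p,q} ∩ Hᵃ`** (`p + q = a`, `(a + 2) + d = 2g`, `p' = g - q - 1`, `q' = g - p - 1` the intermediate type in
degree `d` — as in p09's `weylOperator_of_apply_mem_typeSubmodule` the bookkeeping equations presuppose `p, q ≤ g - 1`; `η` of type `(1,1)` non-degenerate): `*_L` reflects the type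
(`(p,q) ∩ Hᵃ ↦ (g-q, g-p) ∩ H^{2g-a}`, row g50-#6) and `L_η` raises it by `(1,1)`; "proportionnel à `ᶜΛ`", which has bidegree `(-1,-1)`.
[cite: Huybrechts2005, §1.2 Rem. 1.2.33] [cite: VoisinHodgeI2002, §6.2.3 Rem. 6.27] [cite: Andre1996Motifs, §1.1 (p. 11)] -/
theorem conj_lefschetzInvolution_of_apply_mem_typeSubmodule (h11 : ∀ u v : E, η ![Complex.I • u, Complex.I • v] = η ![u, v])
    (hη : ∀ v : E, v ≠ 0 → ∃ w : E, η ![v, w] ≠ 0) {a d p q p' q' : ℕ} (had : (a + 2) + d = 2 * finrank ℂ E) (hpq : p + q = a)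
    (hp' : p' + (q + 1) = finrank ℂ E) (hq' : q' + (p + 1) = finrank ℂ E) {x : E [⋀^Fin (a + 2)]→L[ℝ] ℂ}
    (hx : x ∈ typeSubmodule E (a + 2) (p + 1) (q + 1)) :
    ((hasLefschetzProperty_lefschetzG hη).lefschetzInvolution isZGrading_countingG * lefschetzG η *
        (hasLefschetzProperty_lefschetzG hη).lefschetzInvolution isZGrading_countingG) (GForm.of (a + 2) x) a ∈ typeSubmodule E a p q := by
  -- unfold the three homogeneous steps as in `conj_lefschetzInvolution_of_eq_of`; the intermediate type is `(p', q') = (g-q-1, g-p-1)` in degree `d`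
  have h1 : (hasLefschetzProperty_lefschetzG hη).lefschetzInvolution isZGrading_countingG (GForm.of (a + 2) x) d ∈ typeSubmodule E d p' q' :=
    lefschetzInvolution_of_apply_mem_typeSubmodule h11 hη had (by omega) hp' hq' hx
  have h2 : lefschetzPow η 1 (show 2 * 1 + d = d + 2 by omega)
      ((hasLefschetzProperty_lefschetzG hη).lefschetzInvolution isZGrading_countingG (GForm.of (a + 2) x) d) ∈ typeSubmodule E (d + 2) (p' + 1) (q' + 1) := by
    have hL := lefschetzPow_mem_typeSubmodule h11 1 (show 2 * 1 + d = d + 2 by omega) (show p' + q' = d by omega) h1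
    rwa [add_comm 1 p', add_comm 1 q'] at hL
  have h3 := lefschetzInvolution_of_apply_mem_typeSubmodule h11 hη (show (d + 2) + a = 2 * finrank ℂ E by omega) (show (p' + 1) + (q' + 1) = d + 2 by omega)
    (show p + (q' + 1) = finrank ℂ E by omega) (show q + (p' + 1) = finrank ℂ E by omega) h2
  rwa [Module.End.mul_apply, Module.End.mul_apply, lefschetzInvolution_of_eq_of hη had x, lefschetzG_of,
    lefschetzInvolution_of_eq_of hη (show (d + 2) + a = 2 * finrank ℂ E by omega), GForm.of_apply_self]

/-- **`ᶜL` maps the Hodge classes `H^{a+2}(X, ℚ) ∩ H^{p+1,p+1}` into the Hodge classes `Hᵃ(X, ℚ) ∩ H^{p,p}`** (`p + p = a`, `(a + 2) + d = 2g`, `p' + p + 1 = g`), for every non-degenerate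
`η ∈ NS(X)`: rationality (`ᶜL ∈ 𝔤𝔩(H•(X; ℚ))`) and bidegree `(-1,-1)`. [cite: Milne1999LefschetzClasses, §5 p. 665 and Thm. 5.9] [cite: Andre1996Motifs, §1.1 (p. 11)]
[cite: Lange2023AbelianVarietiesComplex, §7.2.2] -/
theorem IsNSForm.conj_lefschetzInvolution_of_apply_mem_hodgeClassesIn (hNS : IsNSForm Φ η) (hη : ∀ v : E, v ≠ 0 → ∃ w : E, η ![v, w] ≠ 0)
    {a d p p' : ℕ} (had : (a + 2) + d = 2 * finrank ℂ E) (hpa : p + p = a) (hp' : p' + (p + 1) = finrank ℂ E) {x : E [⋀^Fin (a + 2)]→L[ℝ] ℂ}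
    (hx : x ∈ hodgeClassesIn Φ (a + 2) (p + 1)) :
    ((hasLefschetzProperty_lefschetzG hη).lefschetzInvolution isZGrading_countingG * lefschetzG η *
        (hasLefschetzProperty_lefschetzG hη).lefschetzInvolution isZGrading_countingG) (GForm.of (a + 2) x) a ∈ hodgeClassesIn Φ a p :=
  ⟨(mem_rationalFormsG_iff Φ).1 ((hNS.conj_lefschetzInvolution_mem_rationalEnd Φ hη) _ (of_mem_rationalFormsG Φ hx.1)) a,
    conj_lefschetzInvolution_of_apply_mem_typeSubmodule hNS.type_one_one hη had hpa hp' hp' hx.2⟩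

end Structure

/-! ## §5 André's Lemme 1.1: Milne's Lefschetz projectors are Kleiman's `Lʳ ᶜLʳ - L^{r+1} ᶜL^{r+1}` -/

section Projectors

variable {E : Type uE} [NormedAddCommGroup E] [NormedSpace ℂ E] [FiniteDimensional ℂ E] [Nontrivial E] {η : E [⋀^Fin 2]→L[ℝ] ℝ}
  (hη : ∀ v : E, v ≠ 0 → ∃ w : E, η ![v, w] ≠ 0)

include hη

/-- **MILNE'S PROJECTOR `π_{a,r}` (the Lagrange polynomial `ℓ_r(ᶜΛ L)`, p09's `primitiveProj η a r`) IS KLEIMAN–ANDRÉ'S `Lʳ ᶜLʳ - L^{r+1} ᶜL^{r+1}` on `Hᵃ(X; ℂ)`**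
(`a ≤ 2g`, every `r`): on a string `Lʲχ` both sides are `Lʲχ` if `j = r` and `0` otherwise (`Lⁱ ᶜLⁱ` is the projector onto the string positions `≥ i`, p34's
`IsStringReversal.pow_mul_conj_pow_apply`; p09's `primitiveProj_lefschetzPow_of_mem_primitiveForms`). André's Lemme 1.1 read with `x ↦ *_L x`: "la composante de
Lefschetz de `* x` dans `Lⁱ P^{…}(X)` est donnée par `Lⁱ * Lⁱ x - L^{i+1} * L^{i+1} x`". [cite: Andre1996Motifs, §1.1 Lemme 1.1 (p. 11 = p0008 L17–L22)]
[cite: Kleiman1968AlgebraicCycles, §1.4, 1.4.4] [cite: Milne1999LefschetzClasses, §5 pp. 664–665 (proof of Thm. 5.9)] -/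
theorem of_primitiveProj_eq_sub_pow_mul_conj_pow_apply_of {a : ℕ} (ha : a ≤ 2 * finrank ℂ E) (r : ℕ) (x : E [⋀^Fin a]→L[ℝ] ℂ) :
    GForm.of a (primitiveProj η a r x) =
      (lefschetzG η ^ r * ((hasLefschetzProperty_lefschetzG hη).lefschetzInvolution isZGrading_countingG * lefschetzG η *
          (hasLefschetzProperty_lefschetzG hη).lefschetzInvolution isZGrading_countingG) ^ r -
        lefschetzG η ^ (r + 1) * ((hasLefschetzProperty_lefschetzG hη).lefschetzInvolution isZGrading_countingG * lefschetzG η *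
          (hasLefschetzProperty_lefschetzG hη).lefschetzInvolution isZGrading_countingG) ^ (r + 1)) (GForm.of a x) := by
  set L := hasLefschetzProperty_lefschetzG hη with hL
  have hs := L.isStringReversal_lefschetzInvolution isZGrading_countingG
  refine lefschetzSummand_induction hη ha (C := fun x ↦ GForm.of a (primitiveProj η a r x) =
      (lefschetzG η ^ r * (L.lefschetzInvolution isZGrading_countingG * lefschetzG η * L.lefschetzInvolution isZGrading_countingG) ^ r -
        lefschetzG η ^ (r + 1) * (L.lefschetzInvolution isZGrading_countingG * lefschetzG η * L.lefschetzInvolution isZGrading_countingG) ^ (r + 1))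
          (GForm.of a x)) (fun j k h hj α hα ↦ ?_) ?_ (fun x y hx hy ↦ ?_) x
  · have hp := of_mem_primitiveSpace_of_mem_primitiveForms hη (n := finrank ℂ E - k) (by omega) hα
    rw [primitiveProj_lefschetzPow_of_mem_primitiveForms hη h hj hα r, ← lefschetzG_pow_of η j h α, LinearMap.sub_apply,
      hs.pow_mul_conj_pow_apply hp r (show j ≤ finrank ℂ E - k by omega), hs.pow_mul_conj_pow_apply hp (r + 1) (show j ≤ finrank ℂ E - k by omega)]
    by_cases hrj : r = j
    · subst hrj
      rw [if_pos rfl, if_pos le_rfl, if_neg (by omega), sub_zero, lefschetzG_pow_of]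
    · rw [if_neg hrj, GForm.of_zero]
      by_cases hle : r ≤ j
      · rw [if_pos hle, if_pos (by omega), sub_self]
      · rw [if_neg hle, if_neg (by omega), sub_zero]
  · simp only [_root_.map_zero, GForm.of_zero]
  · simp only [_root_.map_add, GForm.of_add, hx, hy]

/-- **ANDRÉ'S LEMME 1.1 ON THE TORUS: the Lefschetz component of `*_L x` in position `r` is `(Lʳ *_L Lʳ - L^{r+1} *_L L^{r+1}) x`** (`x ∈ Hᵃ(X; ℂ)`, `a + b = 2g`):
`of b (π_{b,r}((*_L x)_b)) = (Lʳ *_L Lʳ - L^{r+1} *_L L^{r+1})(of a x)` ("on constate un télescopage"; `*_L Lⁱ *_L *_L = *_L Lⁱ` as `*_L² = 1`, and `(*_L L *_L)ⁱ = *_L Lⁱ *_L`).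
[cite: Andre1996Motifs, §1.1 Lemme 1.1 (p. 11 = p0008 L17–L22)] -/
theorem of_primitiveProj_lefschetzInvolution_of_apply_eq {a b : ℕ} (hab : a + b = 2 * finrank ℂ E) (r : ℕ) (x : E [⋀^Fin a]→L[ℝ] ℂ) :
    GForm.of b (primitiveProj η b r ((hasLefschetzProperty_lefschetzG hη).lefschetzInvolution isZGrading_countingG (GForm.of a x) b)) =
      (lefschetzG η ^ r * (hasLefschetzProperty_lefschetzG hη).lefschetzInvolution isZGrading_countingG * lefschetzG η ^ r -
        lefschetzG η ^ (r + 1) * (hasLefschetzProperty_lefschetzG hη).lefschetzInvolution isZGrading_countingG * lefschetzG η ^ (r + 1))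
          (GForm.of a x) := by
  set L := hasLefschetzProperty_lefschetzG hη with hL
  -- `(s e s)ⁱ = s eⁱ s` and `s eⁱ s (s y) = s eⁱ y`
  have hconj : ∀ i : ℕ, (L.lefschetzInvolution isZGrading_countingG * lefschetzG η * L.lefschetzInvolution isZGrading_countingG) ^ i =
      L.lefschetzInvolution isZGrading_countingG * lefschetzG η ^ i * L.lefschetzInvolution isZGrading_countingG := by
    intro i
    induction i with
    | zero => rw [pow_zero, pow_zero, mul_one, L.lefschetzInvolution_mul_self isZGrading_countingG]
    | succ i ih =>
      rw [pow_succ, ih, pow_succ, mul_assoc (L.lefschetzInvolution isZGrading_countingG * lefschetzG η ^ i),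
        ← mul_assoc (L.lefschetzInvolution isZGrading_countingG) (L.lefschetzInvolution isZGrading_countingG * lefschetzG η),
        ← mul_assoc (L.lefschetzInvolution isZGrading_countingG) (L.lefschetzInvolution isZGrading_countingG),
        L.lefschetzInvolution_mul_self isZGrading_countingG, one_mul, ← mul_assoc, mul_assoc _ (lefschetzG η ^ i) (lefschetzG η)]
  have key := of_primitiveProj_eq_sub_pow_mul_conj_pow_apply_of hη (a := b) (by omega) r (L.lefschetzInvolution isZGrading_countingG (GForm.of a x) b)
  rw [← lefschetzInvolution_of_eq_of hη hab x, hconj r, hconj (r + 1)] at key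
  rw [key]
  simp only [LinearMap.sub_apply, Module.End.mul_apply, L.lefschetzInvolution_lefschetzInvolution isZGrading_countingG]

end Projectors

end ComplexTorus

end Literature.Geometry.Kaehler

end
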